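import Literature.AlgebraicGeometry.HodgeTheory.TopDegreeClasses
import Literature.AlgebraicGeometry.HodgeTheory.SupportedClassesRationalProofs
import Literature.AlgebraicGeometry.HodgeTheory.ComplexGysinHodgeType
import Literature.AlgebraicGeometry.HodgeTheory.ComplexConjugationHolds
import Literature.AlgebraicGeometry.Motives.AbelianVarietyCohomologyExteriorH1
import Literature.AlgebraicGeometry.Motives.HyperbolicWeilTypeProduct
import Summits.HodgeConjecture.HodgeConjecture.Theorems.CYFormCasimirCYFormCarrierEightAnchorCYForm
import HarnessLib

/-!
# Crux X1 `CYFormCarrierEight` (route `CYFormCasimir`, stmt-HodgeConjecture-23493), helper file 3: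
# the carrier block `HasCarrier A T` reduces to its TRANSPORT clause for an abelian-fourfold carrier

research route conditional on HC_CM; not a corollary. Nothing here proves HC, HC_CM, the rung H2, X1, the route
or the rung `stub_carrier_at_CM_point`; this file isolates what is OPEN in the rung.

The carrier block of X1 (`HasCarrier A T` of `Cruxes/CYFormCarrierEight/Lines/birth.lean`, inlined verbatim) asks
for a smooth projective `Y` (dim `m`), `T_Y ⊂ H⁴(Y)` with `dim T_Y = 70`, spanned by rational and by pure-type
classes, `T_Y ⊔ Alg²(Y) = ⊤`, every rational `(4,4)`-class of `span(T_Y ⌣ T_Y) ⊂ H⁸(Y)` algebraic, and a smooth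
projective eightfold `W`, `p : W ↠ A.X`, `f : W → Y` with `f^*T_Y = p^*T`. For `Y = B.X` an ABELIAN FOURFOLD and
`T_Y = H⁴(B) = ⊤` (the line card's named candidate family (c), `m = 4`: `Y = E₀⁴`), EVERY `Y`-side clause holds
unconditionally on the tree's carriers (`hasCarrier_of_transport`): `b₄(B) = C(8,4) = 70`
(`abelianVarietyCohomologyExteriorH1_holds`), `H⁴` is spanned by rational classes
(`span_isRationalClass_eq_top_of_isSmoothProjective_holds`) and by pure-type classes (Hodge decomposition of a
Hodge model), `⊤ ⊔ Alg² = ⊤`, and `H⁸(B)` consists of algebraic classes (top degree = class of a point,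
`mem_algebraicClasses_of_degree_top`). What remains of `HasCarrier A T` is EXACTLY the transport clause
`f^*H⁴(B) = p^*T` for some smooth projective eightfold `W ↠ A.X`, `W → B` — the live clause named by the
line card (exterior-algebra no-go for `W` abelian: `f^*H⁴(B) = ⋀⁴(f^*H¹(B))` is never the graph `T`).

References: vanGeemenRapagnetta2026WeilHK (§1.15), FriedmanLaza2013 (§2.4.2, p. 4), LangeBirkenhake1992
(Exercise 1.1.6 (8)), VoisinHodgeI2002 (§7.1.1, §11.1.2).
-/

-- `Summit.HodgeConjecture.HodgeConjecture.…` is the tree's mandated summit/problem namespace (single-problem summit).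
set_option linter.dupNamespace false
noncomputable section

open CategoryTheory
open Literature.AlgebraicTopology.SingularHomology
open Literature.AlgebraicGeometry.Motives
open Literature.AlgebraicGeometry.HodgeTheory
open Literature.AlgebraicGeometry.Motives.AbelianVariety (prodLift fst snd)

namespace Summit.HodgeConjecture.HodgeConjecture.Theorems.CYFormCarrier

/-! ## §1 The `Y`-side clauses for `Y` smooth projective / an abelian fourfold, `T_Y = ⊤` -/

section YSide

variable {m : ℕ} {Y : SchemeOver ℂ}

/-- `Hᵏ(Y(ℂ); ℂ)` is spanned by its rational classes (`Y` smooth projective), in the clause shape `c ∈ ⊤ ∧ …`.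
[cite: VoisinHodgeI2002, §7.1.1] -/
theorem top_le_span_isRationalClass (hY : IsSmoothProjective m Y) (k : ℕ) :
    (⊤ : Submodule ℂ (complexBetti Y k)) ≤
      Submodule.span ℂ {c | c ∈ (⊤ : Submodule ℂ (complexBetti Y k)) ∧ IsRationalClass c} := by
  have hset : {c | c ∈ (⊤ : Submodule ℂ (complexBetti Y k)) ∧ IsRationalClass c} =
      {c : complexBetti Y k | IsRationalClass c} := by
    ext c; simp
  rw [hset, span_isRationalClass_eq_top_of_isSmoothProjective_holds m Y hY k]

/-- `Hᵏ(Y(ℂ); ℂ)` is spanned by its pure-type classes (the Hodge decomposition of a Hodge model of the smooth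
projective `Y`), in the clause shape. [cite: VoisinHodgeI2002, §6.1.3 and §7.1.1] -/
theorem top_le_span_pureType (hY : IsSmoothProjective m Y) (k : ℕ) :
    (⊤ : Submodule ℂ (complexBetti Y k)) ≤
      Submodule.span ℂ {c | c ∈ (⊤ : Submodule ℂ (complexBetti Y k)) ∧
        ∃ p q : ℕ, p + q = k ∧ IsOfHodgeType m Y k p q c} := by
  classical
  intro c _
  obtain ⟨A⟩ := nonempty_hodgeModel_holds hY
  obtain ⟨z, hz, hzt⟩ := A.exists_sum_eq_of_hodgeDecomposition k c
  rw [← hz]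
  refine Submodule.sum_mem _ fun i hi => Submodule.subset_span ⟨Submodule.mem_top, i.1, i.2, ?_, ⟨A, hzt i hi⟩⟩
  exact Finset.HasAntidiagonal.mem_antidiagonal.1 hi

/-- **Every top-degree class of an abelian fourfold is algebraic** (`H⁸(B) = ℂ·[pt]`), in the clause shape of
`HasCarrier` (the rational `(4,4)`-classes of `span(T_Y ⌣ T_Y) ⊂ H⁸`). [cite: VoisinHodgeI2002, §11.1.2] -/
theorem cup_clause_of_dim_four {B : AbelianVariety ℂ} (hB : B.dim = 4)
    (TY : Submodule ℂ (complexBetti B.X (2 * 2))) :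
    ∀ c ∈ Submodule.span ℂ {x | ∃ u ∈ TY, ∃ v ∈ TY,
        x = cupProduct (show 2 * 2 + 2 * 2 = 2 * 4 from rfl) u v},
      IsRationalClass c → IsOfHodgeType 4 B.X (2 * 4) 4 4 c → c ∈ algebraicClasses B.X 4 :=
  fun c _ _ _ => mem_algebraicClasses_of_degree_top (isSmoothProjective_of_dim_eq' hB) (by norm_num) c

/-- `b₄(B) = C(8,4) = 70` for an abelian fourfold (`dim ⊤ = dim H⁴`). [cite: LangeBirkenhake1992, Exercise 1.1.6 (8)] -/
theorem finrank_top_four_of_dim_four {B : AbelianVariety ℂ} (hB : B.dim = 4) :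
    Module.finrank ℂ (⊤ : Submodule ℂ (complexBetti B.X (2 * 2))) = 70 := by
  rw [finrank_top, abelianVarietyCohomologyExteriorH1_holds.finrank_eq B (2 * 2), hB]
  decide

end YSide

/-! ## §2 `HasCarrier A T` from a transport datum to an abelian fourfold -/

section Transport

variable {A B : AbelianVariety ℂ}

/-- **`HasCarrier A T` (verbatim the carrier block of X1) follows from a TRANSPORT DATUM**: an abelian fourfold
`B`, a smooth projective eightfold `W` with `p : W ↠ A.X`, `f : W → B.X`, and `f^*H⁴(B) = p^*T` in `H⁴(W(ℂ); ℂ)`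
— with `m = 4`, `Y = B.X`, `T_Y = ⊤`; all `Y`-side clauses are discharged by §1. [cite: vanGeemenRapagnetta2026WeilHK, §1.15]
[cite: FriedmanLaza2013, §2.4.2] -/
theorem hasCarrier_of_transport (hB : B.dim = 4) (T : Submodule ℂ (complexBetti A.X (2 * 2)))
    (W : SchemeOver ℂ) (hW : IsSmoothProjective (2 * 4) W) (p : W ⟶ A.X) (hp : AlgebraicGeometry.Surjective p.left)
    (f : W ⟶ B.X)
    (htr : (⊤ : Submodule ℂ (complexBetti B.X (2 * 2))).map (complexBetti.map f (2 * 2)).hom =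
      T.map (complexBetti.map p (2 * 2)).hom) :
    ∃ (m : ℕ) (Y : Literature.AlgebraicGeometry.Motives.SchemeOver ℂ)
      (_ : Literature.AlgebraicGeometry.Motives.IsSmoothProjective m Y)
      (TY : Submodule ℂ (Literature.AlgebraicGeometry.HodgeTheory.complexBetti Y (2 * 2)))
      (W : Literature.AlgebraicGeometry.Motives.SchemeOver ℂ)
      (_ : Literature.AlgebraicGeometry.Motives.IsSmoothProjective (2 * 4) W) (p : W ⟶ A.X)
      (_ : AlgebraicGeometry.Surjective p.left) (f : W ⟶ Y),
      Module.finrank ℂ TY = 70 ∧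
      TY ≤ Submodule.span ℂ {c | c ∈ TY ∧ Literature.AlgebraicGeometry.HodgeTheory.IsRationalClass c} ∧
      TY ≤ Submodule.span ℂ {c | c ∈ TY ∧ ∃ p q : ℕ, p + q = 4 ∧
        Literature.AlgebraicGeometry.HodgeTheory.IsOfHodgeType m Y (2 * 2) p q c} ∧
      TY ⊔ Literature.AlgebraicGeometry.HodgeTheory.algebraicClasses Y 2 = ⊤ ∧
      (∀ c ∈ Submodule.span ℂ {x | ∃ u ∈ TY, ∃ v ∈ TY,
          x = Literature.AlgebraicTopology.SingularHomology.cupProduct (show 2 * 2 + 2 * 2 = 2 * 4 from rfl) u v},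
        Literature.AlgebraicGeometry.HodgeTheory.IsRationalClass c →
        Literature.AlgebraicGeometry.HodgeTheory.IsOfHodgeType m Y (2 * 4) 4 4 c →
        c ∈ Literature.AlgebraicGeometry.HodgeTheory.algebraicClasses Y 4) ∧
      TY.map (Literature.AlgebraicGeometry.HodgeTheory.complexBetti.map f (2 * 2)).hom =
        T.map (Literature.AlgebraicGeometry.HodgeTheory.complexBetti.map p (2 * 2)).hom :=
  ⟨4, B.X, isSmoothProjective_of_dim_eq' hB, ⊤, W, hW, p, hp, f, finrank_top_four_of_dim_four hB,
    top_le_span_isRationalClass (isSmoothProjective_of_dim_eq' hB) (2 * 2),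
    top_le_span_pureType (isSmoothProjective_of_dim_eq' hB) (2 * 2), top_sup_eq _,
    cup_clause_of_dim_four hB ⊤, htr⟩

end Transport


/-! ## §3 The rung `stub_carrier_at_CM_point` reduces to ONE transport clause at the explicit CY form `T₀` -/

section Rung

variable {E₀ B : AbelianVariety ℂ} {d : ℕ} {ψ₀ : E₀ ⟶ E₀}

/-- **The rung `stub_carrier_at_CM_point` CLOSED MODULO ITS TRANSPORT CLAUSE.** At the CM anchor `P = S⁴`,
`S = E₀ × E₀`, `ψ = (ψ₀ × (-ψ₀))⁴` (`d > 0`, `dim E₀ = 1`, `ψ₀ ≫ ψ₀ = -d`), with the EXPLICIT CY form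
`T₀ = (𝟙 + σ^*)(⋀⁴W^*)` (`σ = s⁴` the swap involution; helper file 2): if SOME abelian fourfold `B` and SOME smooth
projective eightfold `W` with `p : W ↠ P.X`, `f : W → B.X` satisfy the transport clause `f^*H⁴(B) = p^*T₀`, then the
rung's conclusion `∃ T, IsCYFormAt d P ψ T ∧ HasCarrier P T` holds (both clause bundles inlined verbatim). The
transport clause itself is NOT proved (it is the live clause of the line card; for `W` abelian and `f` a homomorphism
`f^*H⁴(B) = ⋀⁴(f^*H¹(B))` is never `T₀`). [cite: FriedmanLaza2013, §2.4.2] [cite: vanGeemenRapagnetta2026WeilHK, §1.15]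
[cite: Schoen1998HodgeWeilAddendum, §10] -/
theorem carrier_at_CM_point_of_transport (hd : 0 < d) (hE : E₀.dim = 1) (hψ : ψ₀ ≫ ψ₀ = -(d • 𝟙 E₀))
    (hB : B.dim = 4) (W : SchemeOver ℂ) (hW : IsSmoothProjective (2 * 4) W)
    (p : W ⟶ ((((E₀.prod E₀).prod (E₀.prod E₀)).prod (E₀.prod E₀)).prod (E₀.prod E₀)).X) (hp : AlgebraicGeometry.Surjective p.left) (f : W ⟶ B.X)
    (htr : (⊤ : Submodule ℂ (complexBetti B.X (2 * 2))).map (complexBetti.map f (2 * 2)).hom =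
      ((weilClassesMinus ((((E₀.prod E₀).prod (E₀.prod E₀)).prod (E₀.prod E₀)).prod (E₀.prod E₀)) (prodLift (fst (((E₀.prod E₀).prod (E₀.prod E₀)).prod (E₀.prod E₀)) (E₀.prod E₀) ≫ prodLift (fst ((E₀.prod E₀).prod (E₀.prod E₀)) (E₀.prod E₀) ≫ prodLift (fst (E₀.prod E₀) (E₀.prod E₀) ≫ prodLift (fst E₀ E₀ ≫ ψ₀) (snd E₀ E₀ ≫ (-ψ₀))) (snd (E₀.prod E₀) (E₀.prod E₀) ≫ prodLift (fst E₀ E₀ ≫ ψ₀) (snd E₀ E₀ ≫ (-ψ₀)))) (snd ((E₀.prod E₀).prod (E₀.prod E₀)) (E₀.prod E₀) ≫ prodLift (fst E₀ E₀ ≫ ψ₀) (snd E₀ E₀ ≫ (-ψ₀)))) (snd (((E₀.prod E₀).prod (E₀.prod E₀)).prod (E₀.prod E₀)) (E₀.prod E₀) ≫ prodLift (fst E₀ E₀ ≫ ψ₀) (snd E₀ E₀ ≫ (-ψ₀)))) 2 d).map (LinearMap.id + (complexBetti.map (prodLift (fst (((E₀.prod E₀).prod (E₀.prod E₀)).prod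 (E₀.prod E₀)) (E₀.prod E₀) ≫ prodLift (fst ((E₀.prod E₀).prod (E₀.prod E₀)) (E₀.prod E₀) ≫ prodLift (fst (E₀.prod E₀) (E₀.prod E₀) ≫ prodLift (snd E₀ E₀) (fst E₀ E₀)) (snd (E₀.prod E₀) (E₀.prod E₀) ≫ prodLift (snd E₀ E₀) (fst E₀ E₀))) (snd ((E₀.prod E₀).prod (E₀.prod E₀)) (E₀.prod E₀) ≫ prodLift (snd E₀ E₀) (fst E₀ E₀))) (snd (((E₀.prod E₀).prod (E₀.prod E₀)).prod (E₀.prod E₀)) (E₀.prod E₀) ≫ prodLift (snd E₀ E₀) (fst E₀ E₀))).hom.hom.hom (2 * 2)).hom)).map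
        (complexBetti.map p (2 * 2)).hom) :
    ∃ T : Submodule ℂ (complexBetti ((((E₀.prod E₀).prod (E₀.prod E₀)).prod (E₀.prod E₀)).prod (E₀.prod E₀)).X (2 * 2)),
        (T ≤ pullbackEigenclasses ((((E₀.prod E₀).prod (E₀.prod E₀)).prod (E₀.prod E₀)).prod (E₀.prod E₀)) (prodLift (fst (((E₀.prod E₀).prod (E₀.prod E₀)).prod (E₀.prod E₀)) (E₀.prod E₀) ≫ prodLift (fst ((E₀.prod E₀).prod (E₀.prod E₀)) (E₀.prod E₀) ≫ prodLift (fst (E₀.prod E₀) (E₀.prod E₀) ≫ prodLift (fst E₀ E₀ ≫ ψ₀) (snd E₀ E₀ ≫ (-ψ₀))) (snd (E₀.prod E₀) (E₀.prod E₀) ≫ prodLift (fst E₀ E₀ ≫ ψ₀) (snd E₀ E₀ ≫ (-ψ₀)))) (snd ((E₀.prod E₀).prod (E₀.prod E₀)) (E₀.prod E₀) ≫ prodLift (fst E₀ E₀ ≫ ψ₀) (snd E₀ E₀ ≫ (-ψ₀)))) (snd (((E₀.prod E₀).prod (E₀.prod E₀)).prod (E₀.prod E₀)) (E₀.prod E₀)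 ≫ prodLift (fst E₀ E₀ ≫ ψ₀) (snd E₀ E₀ ≫ (-ψ₀)))) (2 * 2) (fun x y => ((x : ℂ) + (y : ℂ) * Complex.I * (Real.sqrt d : ℂ)) ^ 4) ⊔
            pullbackEigenclasses ((((E₀.prod E₀).prod (E₀.prod E₀)).prod (E₀.prod E₀)).prod (E₀.prod E₀)) (prodLift (fst (((E₀.prod E₀).prod (E₀.prod E₀)).prod (E₀.prod E₀)) (E₀.prod E₀) ≫ prodLift (fst ((E₀.prod E₀).prod (E₀.prod E₀)) (E₀.prod E₀) ≫ prodLift (fst (E₀.prod E₀) (E₀.prod E₀) ≫ prodLift (fst E₀ E₀ ≫ ψ₀) (snd E₀ E₀ ≫ (-ψ₀))) (snd (E₀.prod E₀) (E₀.prod E₀) ≫ prodLift (fst E₀ E₀ ≫ ψ₀) (snd E₀ E₀ ≫ (-ψ₀)))) (snd ((E₀.prod E₀).prod (E₀.prod E₀)) (E₀.prod E₀) ≫ prodLift (fst E₀ E₀ ≫ ψ₀) (snd E₀ E₀ ≫ (-ψ₀)))) (snd (((E₀.prod E₀).prod (E₀.prod E₀)).prod (E₀.prod E₀)) (E₀.prod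 E₀) ≫ prodLift (fst E₀ E₀ ≫ ψ₀) (snd E₀ E₀ ≫ (-ψ₀)))) (2 * 2) (fun x y => ((x : ℂ) - (y : ℂ) * Complex.I * (Real.sqrt d : ℂ)) ^ 4) ∧
        T ⊓ pullbackEigenclasses ((((E₀.prod E₀).prod (E₀.prod E₀)).prod (E₀.prod E₀)).prod (E₀.prod E₀)) (prodLift (fst (((E₀.prod E₀).prod (E₀.prod E₀)).prod (E₀.prod E₀)) (E₀.prod E₀) ≫ prodLift (fst ((E₀.prod E₀).prod (E₀.prod E₀)) (E₀.prod E₀) ≫ prodLift (fst (E₀.prod E₀) (E₀.prod E₀) ≫ prodLift (fst E₀ E₀ ≫ ψ₀) (snd E₀ E₀ ≫ (-ψ₀))) (snd (E₀.prod E₀) (E₀.prod E₀) ≫ prodLift (fst E₀ E₀ ≫ ψ₀) (snd E₀ E₀ ≫ (-ψ₀)))) (snd ((E₀.prod E₀).prod (E₀.prod E₀)) (E₀.prod E₀) ≫ prodLift (fst E₀ E₀ ≫ ψ₀) (snd E₀ E₀ ≫ (-ψ₀)))) (snd (((E₀.prod E₀).prod (E₀.prod E₀)).prod (E₀.prod E₀))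 (E₀.prod E₀) ≫ prodLift (fst E₀ E₀ ≫ ψ₀) (snd E₀ E₀ ≫ (-ψ₀)))) (2 * 2) (fun x y => ((x : ℂ) + (y : ℂ) * Complex.I * (Real.sqrt d : ℂ)) ^ 4) = ⊥ ∧
        Module.finrank ℂ T = 70 ∧
        T ≤ Submodule.span ℂ {c | c ∈ T ∧ IsRationalClass c} ∧
        T ≤ Submodule.span ℂ {c | c ∈ T ∧ ∃ p q : ℕ, p + q = 4 ∧ IsOfHodgeType (2 * 4) ((((E₀.prod E₀).prod (E₀.prod E₀)).prod (E₀.prod E₀)).prod (E₀.prod E₀)).X (2 * 2) p q c}) ∧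
        ∃ (m : ℕ) (Y : Literature.AlgebraicGeometry.Motives.SchemeOver ℂ)
          (_ : Literature.AlgebraicGeometry.Motives.IsSmoothProjective m Y)
          (TY : Submodule ℂ (Literature.AlgebraicGeometry.HodgeTheory.complexBetti Y (2 * 2)))
          (W : Literature.AlgebraicGeometry.Motives.SchemeOver ℂ)
          (_ : Literature.AlgebraicGeometry.Motives.IsSmoothProjective (2 * 4) W) (p : W ⟶ ((((E₀.prod E₀).prod (E₀.prod E₀)).prod (E₀.prod E₀)).prod (E₀.prod E₀)).X)
          (_ : AlgebraicGeometry.Surjective p.left) (f : W ⟶ Y),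
          Module.finrank ℂ TY = 70 ∧
          TY ≤ Submodule.span ℂ {c | c ∈ TY ∧ Literature.AlgebraicGeometry.HodgeTheory.IsRationalClass c} ∧
          TY ≤ Submodule.span ℂ {c | c ∈ TY ∧ ∃ p q : ℕ, p + q = 4 ∧
            Literature.AlgebraicGeometry.HodgeTheory.IsOfHodgeType m Y (2 * 2) p q c} ∧
          TY ⊔ Literature.AlgebraicGeometry.HodgeTheory.algebraicClasses Y 2 = ⊤ ∧
          (∀ c ∈ Submodule.span ℂ {x | ∃ u ∈ TY, ∃ v ∈ TY,
              x = Literature.AlgebraicTopology.SingularHomology.cupProduct (show 2 * 2 + 2 * 2 = 2 * 4 from rfl) u v},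
            Literature.AlgebraicGeometry.HodgeTheory.IsRationalClass c →
            Literature.AlgebraicGeometry.HodgeTheory.IsOfHodgeType m Y (2 * 4) 4 4 c →
            c ∈ Literature.AlgebraicGeometry.HodgeTheory.algebraicClasses Y 4) ∧
          TY.map (Literature.AlgebraicGeometry.HodgeTheory.complexBetti.map f (2 * 2)).hom =
            T.map (Literature.AlgebraicGeometry.HodgeTheory.complexBetti.map p (2 * 2)).hom :=
  ⟨_, isCYForm_fixedForm_pad4Anchor hd hE hψ, hasCarrier_of_transport hB _ W hW p hp f htr⟩

end Rung

end Summit.HodgeConjecture.HodgeConjecture.Theorems.CYFormCarrier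

end
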